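import Summits.Ventures.PercRepro.RankLevelSetLevelSixArithA
import Summits.Ventures.PercRepro.RankLevelSetLevelFourArith
import Summits.Ventures.PercRepro.RankLevelSetMultFifteenDef
import Summits.Ventures.PercRepro.RankLevelSetTailDoubling
import Summits.Ventures.PercRepro.RankLevelSetLevelSixHeavyCellSq27DI2V
import Summits.Ventures.PercRepro.RankLevelSetCoreSixColoopFreeUnion
import Summits.Ventures.PercRepro.RankLevelSetLevelSixCapGlue25
import Summits.Ventures.PercRepro.TriangleCapEightI
import Summits.Ventures.PercRepro.S1TrianglePlusSharp
import Summits.Ventures.PercRepro.S1SeriesLever14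
import Summits.Ventures.PercRepro.RankLevelSetCircuitUnionRank
import Summits.Ventures.PercRepro.RankLevelSetSpanningTrianglesOf
import Summits.Ventures.PercRepro.RankLevelSetLevelSixHeavyCellSq27DI2VSpan

/-!
# PercRepro — THE LEVEL-`6` ARITHMETIC OF THE HEAVY / LIGHT COUNT WITH THE CUBIC MULTIPLICITY, THE DISJOINT PAIR COUNT, THE WINDOWED HEAVY TERM AND THE CIRCUIT TABLES, PART A: `d = 12 … 12`, `p = 22` (fixed rank; the spanning tail cut by 3 triangles), THE 25 ROW ON THE CORRECTED CELL (p8 g14, S3)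

`proofs/SUBCLAIM-S3-p8.md` §3p: the level-`6` polynomial inequalities `(P_d)` for the HEAVY / LIGHT count with p4's CUBIC MULTIPLICITY (weights `1/cube(j + 1)` = `1, 1/5, 1/15, 1/34, 1/65, …`, RankLevelSetMultCubeCount; the `T₅` tail with the `15`-weights) and RATIONAL tails `Kn/Kd` (`Kd = 1000`), ON THE FLAT BOUNDS `f(6) ≤ 39`, `f(5) ≤ 19` (RankLevelSetPlaneTenPrime), WITH THE DISJOINT PAIR COUNT `P(n) = s₃·C(n − 3, 4) + s₄·C(n − 4, 3) + s₅·C(n − 5, 2) + s₆·(n − 6) + s₇` and THE SIZE-CAPPED HEAVY TERM `Σ_{j ≤ d} C(uG, j) + (n + 1)·Σ_{j ≤ d} C(uH, j)` (RankLevelSetDepCountHeavyCap; the cell theorem `c025_core_six_heavy_cell_sq28c`, RankLevelSetLevelSixHeavyCellSq28C: the windowed heavy term, the level-by-level tail, `s₅ ≤ c5` as a hypothesis), the tails in the nullity-cap, the flat-count or the U-count form (the last counts the rank-`≤ 6` sets by the heavy / light count itself, RankLevelSetTailDoubling for its induction step), the unique heavy flat `|UG| ≤ min(39, 6+d)` when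 `2ν₁ ≥ d + 15`, and the circuit bounds: p3's `cq3` table (TriangleCapEightI) for `s₃` at `d ≤ 29`, T⁺⁺⁺ beyond; the `s₄` / `s₅` caps of the tables at `d = 7 … 14` (p2's nullity-only chains avgChain (S1CoreCapChain) / avgChain5b (S1FiveCircuitBase): s₄ ≤ 47 / 70 / 101 / 140 / 190 / 223 / 327 / 418, s₅ ≤ 253 / 432 / 697 / 1078 / 1608 / 2327 / 3280 / 4520), the 4-circuit table and the crude `C(d + 4, 5)` beyond; the right-hand side `C(p + 6, 6)` (the honest cell). Per-corank binomial tails `K·(Σ_{j≤a} C(n,j) + Σ_{j≤d} C(n,j)) ≤ 1000·2^n` (`n ≥ 22 + d`; `a = min(39, 6 + d)`; night-1's `sum_choose_succ_le_two_mul` step from a `norm_num` base). Parameters per corank (ν₁, j, j′, uG, uH, b, K) as in the docstrings; `(P_d)` at `p = 22` (fixed rank; the spanning tail cut by 3 triangles) for every `7 ≤ d ≤ 51`, coefficient positivity at `p = 22 + t` exact. Generated by `lean-drafts/p8/g11/tools/gen23.py 22 39 19 22F12S3le24 42 pq` (CAPS=free14c, RHS_SHIFT=6, KD=1000, SPAN_SHIFT=0,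 HF=1, TRI=1; p8 g14: HF = the H-term factor `(p + d − uH)`, RankLevelSetHeavyWindowFactor / the cell sq27di2v).
Axioms: standard.
-/

namespace PercRepro

/-- The tail at corank `12`, LEVEL-BY-LEVEL form: `20500·(T₅(n) + U₆(p) + Σ_{j ≤ 12} C(n, j)) ≤ 1000·2^n` at `p = 22`, `n = p + 12`, with `T₅` the level-by-level bound of the rank-`≤ 5` sets (`ncard_eRk_le_five_le_levels`) and `U₆` the heavy / light count of all rank-`6` sets with the windowed heavy term (`ν₁ = 9`, weights to `11`). -/
theorem tail_six_heavy_sq22F12S3le24_12_fixed :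
    ((20500 : ℕ) : ℚ) * (((∑ j ∈ Finset.range (3 + 1), (((22 + 12).choose j : ℕ) : ℚ)) +
        (((22 + 12).choose 3 : ℚ) +
        ((∑ j ∈ Finset.range (min 6 (3 + 12) - (3 + 1) + 1),
        ((min (3 - 3) (4 - 2)).choose j : ℚ) * (2 / ((Matroid.mult15 (j + 1) : ℕ) : ℚ))) +
        (∑ j ∈ Finset.range (min 6 (3 + 12) - (3 + 1) + 1),
        ((4 - 2).choose j : ℚ) * (2 / ((Matroid.mult15 (j + 1) : ℕ) : ℚ)))) *
        (((24 : ℕ) : ℚ) * ((((22 + 12) - 3).choose 1 : ℕ) : ℚ) + ((223 : ℕ) : ℚ) * ((((22 + 12) - 4).choose 0 : ℕ) : ℚ))) +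
        (((22 + 12).choose 4 : ℚ) +
        ((∑ j ∈ Finset.range (min 10 (4 + 12) - (4 + 1) + 1),
        ((min (min 6 (3 + 12) - 4) (7 - 2)).choose j : ℚ) * (2 / ((Matroid.mult15 (j + 1) : ℕ) : ℚ))) +
        (∑ j ∈ Finset.range (min 10 (4 + 12) - (4 + 1) + 1),
        ((7 - 2).choose j : ℚ) * (2 / ((Matroid.mult15 (j + 1) : ℕ) : ℚ)))) *
        (((24 : ℕ) : ℚ) * ((((22 + 12) - 3).choose 2 : ℕ) : ℚ) + ((223 : ℕ) : ℚ) * ((((22 + 12) - 4).choose 1 : ℕ) : ℚ) +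
        (((12 + 4).choose 5 : ℕ) : ℚ) * ((((22 + 12) - 5).choose 0 : ℕ) : ℚ))) +
        (((22 + 12).choose 5 : ℚ) +
        ((∑ j ∈ Finset.range (min 19 (5 + 12) - (5 + 1) + 1),
        ((min (min 10 (4 + 12) - 5) (15 - 2)).choose j : ℚ) * (2 / ((Matroid.mult15 (j + 1) : ℕ) : ℚ))) +
        (∑ j ∈ Finset.range (min 19 (5 + 12) - (5 + 1) + 1),
        ((15 - 2).choose j : ℚ) * (2 / ((Matroid.mult15 (j + 1) : ℕ) : ℚ)))) *
        (((24 : ℕ) : ℚ) * ((((22 + 12) - 3).choose 3 : ℕ) : ℚ) + ((223 : ℕ) : ℚ) * ((((22 + 12) - 4).choose 2 : ℕ) : ℚ) +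
        (((12 + 4).choose 5 : ℕ) : ℚ) * ((((22 + 12) - 5).choose 1 : ℕ) : ℚ) +
        (((12 + 5).choose 6 : ℕ) : ℚ) * ((((22 + 12) - 6).choose 0 : ℕ) : ℚ)))) +
      ((((22 + 12).choose 6 : ℕ) : ℚ) +
        ((∑ i ∈ Finset.range (min 39 (6 + 12) - 7 + 1), ((Nat.choose (min (min 19 (5 + 12) - 6) (9 - 2)) i : ℕ) : ℚ) * (1 / ((((i + 1) * ((i + 1) ^ 2 + 1) / 2 : ℕ) : ℚ)))) *
          (((24 : ℕ) : ℚ) * ((22 + 12 - 3).choose 4 : ℚ) + ((223 : ℕ) : ℚ) * ((22 + 12 - 4).choose 3 : ℚ) + ((2327 : ℕ) : ℚ) * ((22 + 12 - 5).choose 2 : ℚ) + ((9724 : ℕ) : ℚ) * ((22 + 12 - 6 : ℕ) : ℚ) + ((24490 : ℕ) : ℚ)) +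
        ((0 : ℕ) : ℚ) * (∑ i ∈ Finset.range (min 39 (6 + 12) - 7 + 1), ((Nat.choose (9 - 2) i : ℕ) : ℚ) * (1 / ((((i + 1) * ((i + 1) ^ 2 + 1) / 2 : ℕ) : ℚ)))) *
          (((24 : ℕ) : ℚ) * ((22 + 12 - 3).choose 4 : ℚ) + ((223 : ℕ) : ℚ) * ((22 + 12 - 4).choose 3 : ℚ) + ((2327 : ℕ) : ℚ) * ((22 + 12 - 5).choose 2 : ℚ) + ((9724 : ℕ) : ℚ) * ((22 + 12 - 6 : ℕ) : ℚ) + ((24490 : ℕ) : ℚ)) +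
        (∑ i ∈ Finset.Icc 6 (min 39 (6 + 12)), ((Nat.choose 21 i : ℕ) : ℚ)) +
          ((∑ i ∈ Finset.Icc 6 (min 39 (6 + 12)), ((Nat.choose 18 i : ℕ) : ℚ)) +
            ((22 + 12 - 18 : ℕ) : ℚ) * (∑ i ∈ Finset.Icc 5 ((min 39 (6 + 12)) - 1), ((Nat.choose 18 i : ℕ) : ℚ))))) +
      ((((∑ j ∈ Finset.range (12 + 1), Nat.choose (22 + 12) j) + 3 * Nat.choose (22 + 12 - 5) 12) - Nat.choose (22 + 12 - 9) (12 - 2) - Nat.choose (22 + 12 - 6) (12 - 1) - 3 * Nat.choose (22 + 12 - 3) 12 - Nat.choose (22 + 12 - 9) 12 : ℕ) : ℚ)) ≤ ((1000 : ℕ) : ℚ) * 2 ^ (22 + 12) := by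
  have hT1 : (∑ j ∈ Finset.range (min 6 (3 + 12) - (3 + 1) + 1),
        ((min (3 - 3) (4 - 2)).choose j : ℚ) * (2 / ((Matroid.mult15 (j + 1) : ℕ) : ℚ))) = (1 : ℚ) := by
    norm_num [Finset.sum_range_succ, Nat.choose, Matroid.mult15]
  have hT2 : (∑ j ∈ Finset.range (min 6 (3 + 12) - (3 + 1) + 1),
        ((4 - 2).choose j : ℚ) * (2 / ((Matroid.mult15 (j + 1) : ℕ) : ℚ))) = (22 / 15 : ℚ) := by
    norm_num [Finset.sum_range_succ, Nat.choose, Matroid.mult15]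
  have hT3 : (∑ j ∈ Finset.range (min 10 (4 + 12) - (4 + 1) + 1),
        ((min (min 6 (3 + 12) - 4) (7 - 2)).choose j : ℚ) * (2 / ((Matroid.mult15 (j + 1) : ℕ) : ℚ))) = (22 / 15 : ℚ) := by
    norm_num [Finset.sum_range_succ, Nat.choose, Matroid.mult15]
  have hT4 : (∑ j ∈ Finset.range (min 10 (4 + 12) - (4 + 1) + 1),
        ((7 - 2).choose j : ℚ) * (2 / ((Matroid.mult15 (j + 1) : ℕ) : ℚ))) = (12895 / 3927 : ℚ) := by
    norm_num [Finset.sum_range_succ, Nat.choose, Matroid.mult15]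
  have hT5 : (∑ j ∈ Finset.range (min 19 (5 + 12) - (5 + 1) + 1),
        ((min (min 10 (4 + 12) - 5) (15 - 2)).choose j : ℚ) * (2 / ((Matroid.mult15 (j + 1) : ℕ) : ℚ))) = (12895 / 3927 : ℚ) := by
    norm_num [Finset.sum_range_succ, Nat.choose, Matroid.mult15]
  have hT6 : (∑ j ∈ Finset.range (min 19 (5 + 12) - (5 + 1) + 1),
        ((15 - 2).choose j : ℚ) * (2 / ((Matroid.mult15 (j + 1) : ℕ) : ℚ))) = (408160693 / 3174920 : ℚ) := by
    norm_num [Finset.sum_range_succ, Nat.choose, Matroid.mult15]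
  have hσ1 : (∑ i ∈ Finset.range (min 39 (6 + 12) - 7 + 1), ((Nat.choose (min (min 19 (5 + 12) - 6) (9 - 2)) i : ℕ) : ℚ) * (1 / ((((i + 1) * ((i + 1) ^ 2 + 1) / 2 : ℕ) : ℚ)))) = (4579863 / 817700 : ℚ) := by
    norm_num [Finset.sum_range_succ, Nat.choose]
  have hσ2 : (∑ i ∈ Finset.range (min 39 (6 + 12) - 7 + 1), ((Nat.choose (9 - 2) i : ℕ) : ℚ) * (1 / ((((i + 1) * ((i + 1) ^ 2 + 1) / 2 : ℕ) : ℚ)))) = (4579863 / 817700 : ℚ) := by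
    norm_num [Finset.sum_range_succ, Nat.choose]
  have hs3 : ((24 : ℕ) : ℚ) = (24 : ℚ) := by norm_num
  have hs4 : ((223 : ℕ) : ℚ) = (223 : ℚ) := by norm_num
  have hs5 : ((2327 : ℕ) : ℚ) = (2327 : ℚ) := by norm_num
  have hs5c : (((12 + 4).choose 5 : ℕ) : ℚ) = (4368 : ℚ) := by norm_num [Nat.choose]
  have hs6 : ((9724 : ℕ) : ℚ) = (9724 : ℚ) := by norm_num
  have hs7 : ((24490 : ℕ) : ℚ) = (24490 : ℚ) := by norm_num
  have hb : ((0 : ℕ) : ℚ) = (0 : ℚ) := by norm_num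
  have hG : (∑ i ∈ Finset.Icc 6 (min 39 (6 + 12)), ((Nat.choose 21 i : ℕ) : ℚ)) = (2069024 : ℚ) := by
    rw [show Finset.Icc 6 (min 39 (6 + 12)) = Finset.Ico 6 19 from (Finset.Ico_succ_right_eq_Icc 6 18).symm, Finset.sum_Ico_eq_sum_range]
    norm_num [Finset.sum_range_succ, Nat.choose]
  have hH : (∑ i ∈ Finset.Icc 6 (min 39 (6 + 12)), ((Nat.choose 18 i : ℕ) : ℚ)) = (249528 : ℚ) := by
    rw [show Finset.Icc 6 (min 39 (6 + 12)) = Finset.Ico 6 19 from (Finset.Ico_succ_right_eq_Icc 6 18).symm, Finset.sum_Ico_eq_sum_range]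
    norm_num [Finset.sum_range_succ, Nat.choose]
  have hH2 : (∑ i ∈ Finset.Icc 5 ((min 39 (6 + 12)) - 1), ((Nat.choose 18 i : ℕ) : ℚ)) = (258095 : ℚ) := by
    rw [show Finset.Icc 5 (min 39 (6 + 12) - 1) = Finset.Ico 5 18 from (Finset.Ico_succ_right_eq_Icc 5 17).symm, Finset.sum_Ico_eq_sum_range]
    norm_num [Finset.sum_range_succ, Nat.choose]
  simp only [hT1, hT2, hT3, hT4, hT5, hT6, hσ1, hσ2, hs3, hs4, hs5, hs5c, hs6, hs7, hb, hG, hH, hH2, Nat.choose_zero_right, Nat.choose_one_right, Nat.cast_one, mul_one]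
  norm_num [Finset.sum_range_succ, Nat.choose]

/-- `(P_12)` at level `6`, heavy / light count with the CUBIC multiplicity (`ν₁ = 9`, `j = 2`, `j′ = 1`, `uG = 21`, `uH = 18`, `b = 0`, `Kn/Kd = 20500/1000`; `σ₁⁺ = 454401/81770`, `σ₂⁺ = 454401/81770`; `s₃ ≤ cq3`, `s₄`, `s₅` by the tables), for every `p ≥ 22`. -/
theorem level_six_poly_heavy_sq22F12S3le24_12_fixed :
    (20500 : ℚ) * ((((22 + 12).choose 6 : ℕ) : ℚ) + (((Nat.choose 24 2 : ℕ) : ℚ) * ((22 + 12 - 5 : ℕ) : ℚ) - ((24 : ℕ) : ℚ) * (((22 + 12 - 3).choose 3 : ℕ) : ℚ) +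
      ((∑ i ∈ Finset.range (12 - 7 + 1), ((Nat.choose (min (min 19 (5 + 12) - 6) (9 - 2)) i : ℕ) : ℚ) * (1 / ((((i + 1) * ((i + 1) ^ 2 + 1) / 2 : ℕ) : ℚ)))) *
        (((24 : ℕ) : ℚ) * ((22 + 12 - 3).choose 4 : ℚ) + ((223 : ℕ) : ℚ) * ((22 + 12 - 4).choose 3 : ℚ) + ((2327 : ℕ) : ℚ) * ((22 + 12 - 5).choose 2 : ℚ) + ((9724 : ℕ) : ℚ) * ((22 + 12 - 6 : ℕ) : ℚ) + ((24490 : ℕ) : ℚ)) +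
      ((0 : ℕ) : ℚ) * (∑ i ∈ Finset.range (12 - 7 + 1), ((Nat.choose (9 - 2) i : ℕ) : ℚ) * (1 / ((((i + 1) * ((i + 1) ^ 2 + 1) / 2 : ℕ) : ℚ)))) *
        (((24 : ℕ) : ℚ) * ((22 + 12 - 3).choose 4 : ℚ) + ((223 : ℕ) : ℚ) * ((22 + 12 - 4).choose 3 : ℚ) + ((2327 : ℕ) : ℚ) * ((22 + 12 - 5).choose 2 : ℚ) + ((9724 : ℕ) : ℚ) * ((22 + 12 - 6 : ℕ) : ℚ) + ((24490 : ℕ) : ℚ)) +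
      (∑ i ∈ Finset.Icc 6 12, ((Nat.choose 21 i : ℕ) : ℚ)) +
          ((∑ i ∈ Finset.Icc 6 12, ((Nat.choose 18 i : ℕ) : ℚ)) +
            ((22 + 12 - 18 : ℕ) : ℚ) * (∑ i ∈ Finset.Icc 5 (12 - 1), ((Nat.choose 18 i : ℕ) : ℚ)))))) ≤
      ((20500 - 1000 : ℕ) : ℚ) * 2 ^ (12 - 6) * (((22 + 6).choose 6 : ℕ) : ℚ) := by
  have hσ1 : (∑ i ∈ Finset.range (12 - 7 + 1), ((Nat.choose (min (min 19 (5 + 12) - 6) (9 - 2)) i : ℕ) : ℚ) * (1 / ((((i + 1) * ((i + 1) ^ 2 + 1) / 2 : ℕ) : ℚ)))) = (454401 / 81770 : ℚ) := by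
    norm_num [Finset.sum_range_succ, Nat.choose]
  have hσ2 : (∑ i ∈ Finset.range (12 - 7 + 1), ((Nat.choose (9 - 2) i : ℕ) : ℚ) * (1 / ((((i + 1) * ((i + 1) ^ 2 + 1) / 2 : ℕ) : ℚ)))) = (454401 / 81770 : ℚ) := by
    norm_num [Finset.sum_range_succ, Nat.choose]
  have hs3 : ((24 : ℕ) : ℚ) = (24 : ℚ) := by norm_num
  have hs4 : ((223 : ℕ) : ℚ) = (223 : ℚ) := by norm_num
  have hs5 : ((2327 : ℕ) : ℚ) = (2327 : ℚ) := by norm_num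
  have hs6 : ((9724 : ℕ) : ℚ) = (9724 : ℚ) := by norm_num
  have hs7 : ((24490 : ℕ) : ℚ) = (24490 : ℚ) := by norm_num
  have hK : ((20500 - 1000 : ℕ) : ℚ) = (19500 : ℚ) := by norm_num
  have hb : ((0 : ℕ) : ℚ) = (0 : ℚ) := by norm_num
  have hG : (∑ i ∈ Finset.Icc 6 12, ((Nat.choose 21 i : ℕ) : ℚ)) = (1667326 : ℚ) := by
    rw [show Finset.Icc 6 12 = Finset.Ico 6 13 from (Finset.Ico_succ_right_eq_Icc 6 12).symm, Finset.sum_Ico_eq_sum_range]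
    norm_num [Finset.sum_range_succ, Nat.choose]
  have hH : (∑ i ∈ Finset.Icc 6 12, ((Nat.choose 18 i : ℕ) : ℚ)) = (236912 : ℚ) := by
    rw [show Finset.Icc 6 12 = Finset.Ico 6 13 from (Finset.Ico_succ_right_eq_Icc 6 12).symm, Finset.sum_Ico_eq_sum_range]
    norm_num [Finset.sum_range_succ, Nat.choose]
  have hH2 : (∑ i ∈ Finset.Icc 5 (12 - 1), ((Nat.choose 18 i : ℕ) : ℚ)) = (226916 : ℚ) := by
    rw [show Finset.Icc 5 (12 - 1) = Finset.Ico 5 12 from (Finset.Ico_succ_right_eq_Icc 5 11).symm, Finset.sum_Ico_eq_sum_range]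
    norm_num [Finset.sum_range_succ, Nat.choose]
  have hc32 : ((Nat.choose 24 2 : ℕ) : ℚ) = (276 : ℚ) := by rw [Nat.choose_two_right]; norm_num
  rw [hc32]
  simp only [hσ1, hσ2, hs3, hs4, hs5, hs6, hs7, hK, hb, hG, hH, hH2]
  norm_num [Finset.sum_range_succ, Nat.choose]

end PercRepro

-- ===== merged: the dispatcher of the part above (p8 g14; the branch s₃ ≤ 21 of the coloop-free cell) =====
/-!
# PercRepro — THE 22 ROW (THE COLOOP DEVICE), CORANK `12`, LEVEL 0: THE HONEST COLOOP-FREE CELL `(22 ≥ 22, 12)` (p8 g14, S3)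

`proofs/SUBCLAIM-S3-p8.md` §3z⁗ (the pieces of `c025_core_six_twentytwo_nine_of`). `(phiK 22 6)·#U ≤ #Y` on a coloop-free `e`-free core of rank `22 ≥ 22`, corank `12`, on the cell `sq27di2v` with the `H`-term factor `22 + 12 − 18` (`ν₁ = 9`, `j = 2`, `j′ = 1`, `|UG| ≤ 21`, `|UH| ≤ 18`, `Kn/Kd = 15466/1000`; `D = C(22 + 6, 6)`; caps `s₃ ≤ 26`, `s₄ ≤ 223`, `s₅ ≤ 2327`, `s₆ ≤ 9724`, `s₇ ≤ 24490` at `n₀ = 34`; parts RankLevelSetLevelSixArithHeavySq22F12S3le24A). Axioms: standard.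
-/

open scoped Matroid

namespace PercRepro

namespace ThmN

open Set

variable {α : Type}

set_option maxHeartbeats 800000 in
/-- **THE HONEST COLOOP-FREE CELL `(22 ≥ 22, 12)` of the `22` row at corank `12`** (level 0, `phiK 22 6`, `D = C(22 + 6, 6)`). -/
theorem c025_core_six_t22_free12_le24_span (M : Matroid α) [M.Finite] (hcf : ∀ e ∈ M.E, ¬ M.IsColoop e)
    (hcap : {C : Set α | M.IsCircuit C ∧ C.ncard = 3}.ncard ≤ 24)
    (hs3 : 3 ≤ {C : Set α | M.IsCircuit C ∧ C.ncard = 3}.ncard)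
    (hR : M.eRank = (22 : ℕ∞)) (hn : M.E.ncard = 22 + 12)
    (hfree : ∀ e ∈ M.E, ∃ A ⊆ M.E \ {e}, e ∉ M.closure A ∧ e ∉ M.closure ((M.E \ {e}) \ A)) :
    RLS M 22 6 := by
  classical
  have hR' : M.eRank = ((22 : ℕ) : ℕ∞) := by simpa using hR
  have hd : M.E.encard = M.eRank + (12 : ℕ) := by
    rw [hR', ← M.ground_finite.cast_ncard_eq, hn]
    push_cast
    ring
  have hL : ∀ e ∈ M.E, ¬ M.IsLoop e := not_isLoop_of_free M hfree
  have hs : ∀ e ∈ M.E, ∀ f ∈ M.E, e ≠ f → M.eRk {e, f} = 2 := by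
    intro e he f hf hef
    have h2 : (2 : ℕ∞) ≤ M.eRk {e, f} :=
      two_le_eRk_of_two_le_ncard_of_free M hfree (pair_subset he hf) (by rw [ncard_pair hef])
    have h3 : M.eRk {e, f} ≤ 2 := by
      have := M.eRk_le_encard {e, f}
      rwa [encard_pair hef] at this
    exact le_antisymm h3 h2
  have hc : ∀ X ⊆ M.E, M.eRk X ≤ ((6 - 2 : ℕ) : ℕ∞) → (X.ncard : ℕ∞) ≤ M.eRk X + cnull 4 :=
    fun X hX hr => nullity_cap_core M hfree 4 (le_refl 4) X hX (by simpa using hr)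
  have hc6 : cnull 4 + 1 ≤ 9 := by simp [cnull]
  have hcj : ∀ X ⊆ M.E, M.eRk X ≤ ((6 - 2 - 1 : ℕ) : ℕ∞) → (X.ncard : ℕ∞) ≤ M.eRk X + cnull (3) :=
    fun X hX hr => nullity_cap_core M hfree 3 (by omega) X hX
      (by rwa [show (6 - 2 - 1 : ℕ) = 3 by omega] at hr)
  have hcj' : ∀ X ⊆ M.E, M.eRk X ≤ ((6 - 1 - 1 - 1 : ℕ) : ℕ∞) → (X.ncard : ℕ∞) ≤ M.eRk X + cnull (3) :=
    fun X hX hr => nullity_cap_core M hfree 3 (by omega) X hX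
      (by rwa [show (6 - 1 - 1 - 1 : ℕ) = 3 by omega] at hr)
  have hUG : (Matroid.UG M 6 9).ncard ≤ 21 := by
    have := Matroid.ncard_UG_le_cf (M := M) (q := 6) (ν₁ := 9) (j := 2) (by norm_num) hcf hR' hn (by omega) hc hc6 hcj (by norm_num [cnull])
    simpa using this
  have hUH : (Matroid.UH M 6 9).ncard ≤ 18 := by
    have := Matroid.ncard_UH_le_cf (M := M) (q := 6) (ν₁ := 9) (j' := 1) (by norm_num) hcf hR' hn (by omega) hc hc6 hcj' (by norm_num [cnull])
    simpa using this
  have hΦ : phiK 22 6 ≤ (2 : ℚ) ^ (22 + 6) / (((22 + 6).choose 6 : ℕ) : ℚ) := phiK_le_two_pow_div_six 22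
  have hC1 : ∀ L ⊆ M.E, M.eRk L = 2 → L.ncard ≤ 3 :=
    fun L hL hr => ncard_le_three_of_eRk_two M hs hfree hL hr
  have hEcard : M.ground_finite.toFinset.card = 22 + 12 := by
    rw [← Set.ncard_eq_toFinset_card _ M.ground_finite]; exact hn
  have hspan := Matroid.ncard_spanning_le_of_three_triangles hC1 hd (by norm_num) hs3
  rw [hEcard] at hspan
  rw [RLS_iff]
  exact c025_core_six_heavy_cell_sq27di2v_span M 22 12 9 21 18 0 20500 1000 18 2327 223 24 9724 24490
      ((22 + 6).choose 6)
      (((∑ j ∈ Finset.range (12 + 1), Nat.choose (22 + 12) j) + 3 * Nat.choose (22 + 12 - 5) 12) - Nat.choose (22 + 12 - 9) (12 - 2) - Nat.choose (22 + 12 - 6) (12 - 1) - 3 * Nat.choose (22 + 12 - 3) 12 - Nat.choose (22 + 12 - 9) 12)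
      (Nat.choose_pos (by omega)) hspan (phiK 22 6) hΦ (by norm_num) (by omega)
      (by norm_num) hUG hUH (by omega) (Or.inl (by norm_num)) (by norm_num) (by norm_num) (by norm_num)
      hcap
      ((S1.ncard_fourCircuits_le_gb14 12 M hfree hd 34 (by rw [coloops_eq_empty_of_forall M hcf, Set.sdiff_empty, hn])).trans (by decide))
      (s5_cf_of M hfree hcf (d := 11) (by rw [hd]; norm_num) 34 1985 2327 (by norm_num) (by omega) (by decide) (by omega))
      (s6_cf_of M hfree hcf (d := 11) (by rw [hd]; norm_num) 34 8008 9724 (by norm_num) (by omega) (by decide) (by omega))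
      (s7_cf_of M hfree hcf (d := 11) (by rw [hd]; norm_num) 34 19448 24490 (by norm_num) (by omega) (by decide) (by omega))
      (Or.inl tail_six_heavy_sq22F12S3le24_12_fixed) hR' hn hfree level_six_poly_heavy_sq22F12S3le24_12_fixed

end ThmN

end PercRepro
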